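import Summits.CriticalPhenomena.PercolationContinuityZ3.Theorems.PercNearOneGluingNoHeavyLowerTailAGPlusBernsteinFibre
import Summits.CriticalPhenomena.PercolationContinuityZ3.Theorems.PercNearOneGluingNoHeavyLowerTailTerminalEdgeStepXiHqtLeFive
import Mathlib.Tactic.Linarith
import HarnessLib

/-!
# `NoHeavyLowerTail` (stmt-CriticalPhenomena-4575) — (BΞ1),(BΞ2) for AG⁺ on every finite weighted graph, II: the clean gluing-pencil forms and
# the tree's `TerminalEdgeStep.xiB₁`, `xiB₂`

Support file (prover prim-l12-p6 gen 3; `--supports stmt-CriticalPhenomena-4575`).  No definitions, no named facts, no sorries.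
* `xiB₁_eq_polar`, `xiB₂_eq_polar` (`ring`): the polarisations `XP12(c⁰; c⁰+δ)`, `XP21(c⁰; c⁰+δ)` of `Ξ = σ(qt−e₂)−e₃` ARE `TerminalEdgeStep.xiB₁/xiB₂ (c⁰,δ)`.
* `xiPolar12_nonneg`, `xiPolar21_nonneg`: for every `PrW D p` (`p ∈ [0,1]`), every pair `e ∉ D`, all `a b c`: `0 ≤ XP12(c⁰;c¹)`, `0 ≤ XP21(c⁰;c¹)` with
  `c⁰` the five three-point cells of the law and `c¹` those of `S ↦ S ∪ {e}` — the two middle Bernstein coefficients of AG⁺ along EVERY one-edge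
  pencil `law(G) → law(G/e)` are `≥ 0` (part I at `insert e D`, weight `½` on `e`).
* `xiB₁_nonneg_of_transitions`, `xiB₂_nonneg_of_transitions`: **(BΞ1),(BΞ2)** — `0 ≤ xiB₁`, `0 ≤ xiB₂` at the cells of `PrW D p` and any reals
  `α₁ … β₃` through which the glued cells decompose (automatic for an apex pair `e ∋ a`).
So the terminal-edge step of AG⁺ (prim-bnk-1 `XiStepUpTo`, in the tree only for `n ≤ 5`; prim-facecert: NOT certifiable by any multiplier
certificate over the proved four-point rows) holds on every finite weighted graph.  [this work]
-/

noncomputable section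

namespace Summit.CriticalPhenomena.PercolationContinuityZ3.Theorems

namespace AGPlusFibre

open Finset Literature.Probability.Percolation Literature.Probability.Percolation.DecisionTree
open Literature.Probability.Percolation.Gladkov ThreePointLB TIncSwitching AGPlusSwitching TIncFibre
open Literature.Probability.Percolation.DecisionTree.DTree2 (ins wt1 mem_ins_self_iff)
open scoped Classical

variable {V : Type*} [Fintype V] [DecidableEq V]

section Algebra

variable {R : Type*} [CommRing R]

/-- `XP12(c⁰; c⁰ + δ) = xiB₁(c⁰, δ)` (`ring`). [folklore] -/
theorem xiB₁_eq_polar (q u₁ u₂ u₃ t α₁ α₂ β₁ β₂ β₃ : R) :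
    TerminalEdgeStep.xiB₁ q u₁ u₂ u₃ t α₁ α₂ β₁ β₂ β₃ =
      (fun (q₀ ua₀ ub₀ uc₀ t₀ q₁ ua₁ ub₁ uc₁ t₁ : R) => q₀ ^ 2 * t₁ - q₀ * ua₀ * ub₁ - q₀ * ua₀ * uc₁ - q₀ * ub₀ * uc₁ + q₀ * t₀ * ua₁ + q₀ * t₀ * ub₁ + q₀ * t₀ * uc₁ + 2 * q₀ * t₀ * t₁ + 2 * q₀ * t₀ * q₁ - q₀ * ub₀ * ua₁ - q₀ * uc₀ * ua₁ - q₀ * uc₀ * ub₁ + q₀ * ua₀ * t₁ + q₀ * ub₀ * t₁ + q₀ * uc₀ * t₁ - ua₀ ^ 2 * ub₁ - ua₀ ^ 2 * uc₁ - 2 * ua₀ * ub₀ * ub₁ - 4 * ua₀ * ub₀ * uc₁ - 2 * ua₀ * uc₀ * uc₁ - 2 * ua₀ * ub₀ * ua₁ - 2 * ua₀ * uc₀ * ua₁ - 4 * ua₀ * uc₀ * ub₁ - ub₀ ^ 2 * uc₁ - 2 * ub₀ * uc₀ * uc₁ - 2 * ub₀ * uc₀ * ub₁ - ua₀ * t₀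 * ub₁ - ua₀ * t₀ * uc₁ - ub₀ * t₀ * uc₁ - ub₀ * t₀ * ua₁ - uc₀ * t₀ * ua₁ - uc₀ * t₀ * ub₁ - ua₀ * ub₀ * q₁ - ua₀ * uc₀ * q₁ - ub₀ * uc₀ * q₁ + t₀ ^ 2 * q₁ + ua₀ * t₀ * q₁ + ub₀ * t₀ * q₁ + uc₀ * t₀ * q₁ - ub₀ ^ 2 * ua₁ - 4 * ub₀ * uc₀ * ua₁ - uc₀ ^ 2 * ua₁ - uc₀ ^ 2 * ub₁ - ua₀ * ub₀ * t₁ - ua₀ * uc₀ * t₁ - ub₀ * uc₀ * t₁)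
        q u₃ u₂ u₁ t (q - α₁ - α₂) (u₃ - β₃) (u₂ + α₂ - β₂) (u₁ + α₁ - β₁) (t + β₁ + β₂ + β₃) := by
  simp only [TerminalEdgeStep.xiB₁]
  ring

/-- `XP21(c⁰; c⁰ + δ) = xiB₂(c⁰, δ)` (`ring`). [folklore] -/
theorem xiB₂_eq_polar (q u₁ u₂ u₃ t α₁ α₂ β₁ β₂ β₃ : R) :
    TerminalEdgeStep.xiB₂ q u₁ u₂ u₃ t α₁ α₂ β₁ β₂ β₃ =
      (fun (q₀ ua₀ ub₀ uc₀ t₀ q₁ ua₁ ub₁ uc₁ t₁ : R) => 2 * q₀ * q₁ * t₁ - q₀ * ua₁ * ub₁ - q₀ * ua₁ * uc₁ - q₀ * ub₁ * uc₁ + q₀ * t₁ ^ 2 + q₀ * ua₁ * t₁ + q₀ * ub₁ * t₁ + q₀ * uc₁ * t₁ - 2 * ua₀ * ua₁ * ub₁ - 2 * ua₀ * ua₁ * uc₁ - ua₀ * ub₁ ^ 2 - 4 * ua₀ * ub₁ * uc₁ - ua₀ * uc₁ ^ 2 - 2 * ub₀ * ub₁ * uc₁ - ub₀ * uc₁ ^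 2 - t₀ * ua₁ * ub₁ - t₀ * ua₁ * uc₁ - t₀ * ub₁ * uc₁ + t₀ * q₁ ^ 2 - ua₀ * q₁ * ub₁ - ua₀ * q₁ * uc₁ - ub₀ * q₁ * uc₁ + t₀ * q₁ * ua₁ + t₀ * q₁ * ub₁ + t₀ * q₁ * uc₁ + 2 * t₀ * q₁ * t₁ - ub₀ * q₁ * ua₁ - uc₀ * q₁ * ua₁ - uc₀ * q₁ * ub₁ + ua₀ * q₁ * t₁ + ub₀ * q₁ * t₁ + uc₀ * q₁ * t₁ - ub₀ * ua₁ ^ 2 - uc₀ * ua₁ ^ 2 - 2 * ub₀ * ua₁ * ub₁ - 4 * ub₀ * ua₁ * uc₁ - 2 * uc₀ * ua₁ * uc₁ - 4 * uc₀ * ua₁ * ub₁ - uc₀ * ub₁ ^ 2 - 2 * uc₀ * ub₁ * uc₁ - ua₀ * ub₁ * t₁ - ua₀ * uc₁ * t₁ - ub₀ * uc₁ * t₁ - ub₀ * ua₁ * t₁ - uc₀ * ua₁ * t₁ - uc₀ * ub₁ * t₁)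
        q u₃ u₂ u₁ t (q - α₁ - α₂) (u₃ - β₃) (u₂ + α₂ - β₂) (u₁ + α₁ - β₁) (t + β₁ + β₂ + β₃) := by
  simp only [TerminalEdgeStep.xiB₂]
  ring

end Algebra

section Pencil

variable {p : Sym2 V → ℝ} (hp0 : ∀ i, 0 ≤ p i) (hp1 : ∀ i, p i ≤ 1) (D : Finset (Sym2 V)) (a b c : V) {e : Sym2 V}

omit [Fintype V] in
/-- `PrW` only depends on the weights on `D`. [folklore] -/
private theorem PrW_congr_weights'' (D : Finset (Sym2 V)) {p p' : Sym2 V → ℝ} (h : ∀ i ∈ D, p' i = p i)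
    (X : Set (Finset (Sym2 V))) : PrW D p' X = PrW D p X := by
  unfold PrW
  refine Finset.sum_congr rfl fun S _ => ?_
  have hw : wtW D p' S = wtW D p S := by
    unfold wtW
    exact Finset.prod_congr rfl fun i hi => by rw [h i hi]
  simp only [Set.indicator, hw]

include hp0 hp1


/-- **(BΞ1) for every gluing pencil**: `0 ≤ XP12(c⁰; c¹)` for every pair `e ∉ D` of every finite weighted graph. [this work] -/
theorem xiPolar12_nonneg (he : e ∉ D) :
    0 ≤ (PrW D p ((conn a b)ᶜ ∩ ((conn a c)ᶜ ∩ (conn b c)ᶜ))) ^ 2 * (PrW D p {S | insert e S ∈ (conn a b ∩ conn a c)}) - (PrW D p ((conn a b)ᶜ ∩ ((conn a c)ᶜ ∩ (conn b c)ᶜ))) * (PrW D p (conn b c ∩ (conn a b)ᶜ)) * (PrW D p {S | insert e S ∈ (conn a c ∩ (conn a b)ᶜ)}) - (PrW D p ((conn a b)ᶜ ∩ ((conn a c)ᶜ ∩ (conn b c)ᶜ))) * (PrW D p (conn b c ∩ (conn a b)ᶜ)) * (PrW D p {S | insert e S ∈ (conn a b ∩ (conn a c)ᶜ)}) - (PrW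 D p ((conn a b)ᶜ ∩ ((conn a c)ᶜ ∩ (conn b c)ᶜ))) * (PrW D p (conn a c ∩ (conn a b)ᶜ)) * (PrW D p {S | insert e S ∈ (conn a b ∩ (conn a c)ᶜ)}) + (PrW D p ((conn a b)ᶜ ∩ ((conn a c)ᶜ ∩ (conn b c)ᶜ))) * (PrW D p (conn a b ∩ conn a c)) * (PrW D p {S | insert e S ∈ (conn b c ∩ (conn a b)ᶜ)}) + (PrW D p ((conn a b)ᶜ ∩ ((conn a c)ᶜ ∩ (conn b c)ᶜ))) * (PrW D p (conn a b ∩ conn a c)) * (PrW D p {S | insert e S ∈ (conn a c ∩ (conn a b)ᶜ)}) + (PrW D p ((conn a b)ᶜ ∩ ((conn a c)ᶜ ∩ (conn b c)ᶜ))) * (PrW D p (conn a b ∩ conn a c)) * (PrW D p {S | insert e S ∈ (conn a b ∩ (conn a c)ᶜ)}) + 2 * (PrW D p ((conn a b)ᶜ ∩ ((conn a c)ᶜ ∩ (conn b c)ᶜ))) * (PrW D p (conn a b ∩ conn a c)) * (PrW D p {S | insert e S ∈ (conn a b ∩ conn a c)}) + 2 * (PrW D p ((conn a b)ᶜ ∩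 ((conn a c)ᶜ ∩ (conn b c)ᶜ))) * (PrW D p (conn a b ∩ conn a c)) * (PrW D p {S | insert e S ∈ ((conn a b)ᶜ ∩ ((conn a c)ᶜ ∩ (conn b c)ᶜ))}) - (PrW D p ((conn a b)ᶜ ∩ ((conn a c)ᶜ ∩ (conn b c)ᶜ))) * (PrW D p (conn a c ∩ (conn a b)ᶜ)) * (PrW D p {S | insert e S ∈ (conn b c ∩ (conn a b)ᶜ)}) - (PrW D p ((conn a b)ᶜ ∩ ((conn a c)ᶜ ∩ (conn b c)ᶜ))) * (PrW D p (conn a b ∩ (conn a c)ᶜ)) * (PrW D p {S | insert e S ∈ (conn b c ∩ (conn a b)ᶜ)}) - (PrW D p ((conn a b)ᶜ ∩ ((conn a c)ᶜ ∩ (conn b c)ᶜ))) * (PrW D p (conn a b ∩ (conn a c)ᶜ)) * (PrW D p {S | insert e S ∈ (conn a c ∩ (conn a b)ᶜ)}) + (PrW D p ((conn a b)ᶜ ∩ ((conn a c)ᶜ ∩ (conn b c)ᶜ))) * (PrW D p (conn b c ∩ (conn a b)ᶜ)) * (PrW D p {S | insert e S ∈ (conn a b ∩ conn a c)}) + (PrW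 D p ((conn a b)ᶜ ∩ ((conn a c)ᶜ ∩ (conn b c)ᶜ))) * (PrW D p (conn a c ∩ (conn a b)ᶜ)) * (PrW D p {S | insert e S ∈ (conn a b ∩ conn a c)}) + (PrW D p ((conn a b)ᶜ ∩ ((conn a c)ᶜ ∩ (conn b c)ᶜ))) * (PrW D p (conn a b ∩ (conn a c)ᶜ)) * (PrW D p {S | insert e S ∈ (conn a b ∩ conn a c)}) - (PrW D p (conn b c ∩ (conn a b)ᶜ)) ^ 2 * (PrW D p {S | insert e S ∈ (conn a c ∩ (conn a b)ᶜ)}) - (PrW D p (conn b c ∩ (conn a b)ᶜ)) ^ 2 * (PrW D p {S | insert e S ∈ (conn a b ∩ (conn a c)ᶜ)}) - 2 * (PrW D p (conn b c ∩ (conn a b)ᶜ)) * (PrW D p (conn a c ∩ (conn a b)ᶜ)) * (PrW D p {S | insert e S ∈ (conn a c ∩ (conn a b)ᶜ)}) - 4 * (PrW D p (conn b c ∩ (conn a b)ᶜ)) * (PrW D p (conn a c ∩ (conn a b)ᶜ)) * (PrW D p {S | insert e S ∈ (conn a b ∩ (conn a c)ᶜ)}) - 2 * (PrW D p (conn b c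 ∩ (conn a b)ᶜ)) * (PrW D p (conn a b ∩ (conn a c)ᶜ)) * (PrW D p {S | insert e S ∈ (conn a b ∩ (conn a c)ᶜ)}) - 2 * (PrW D p (conn b c ∩ (conn a b)ᶜ)) * (PrW D p (conn a c ∩ (conn a b)ᶜ)) * (PrW D p {S | insert e S ∈ (conn b c ∩ (conn a b)ᶜ)}) - 2 * (PrW D p (conn b c ∩ (conn a b)ᶜ)) * (PrW D p (conn a b ∩ (conn a c)ᶜ)) * (PrW D p {S | insert e S ∈ (conn b c ∩ (conn a b)ᶜ)}) - 4 * (PrW D p (conn b c ∩ (conn a b)ᶜ)) * (PrW D p (conn a b ∩ (conn a c)ᶜ)) * (PrW D p {S | insert e S ∈ (conn a c ∩ (conn a b)ᶜ)}) - (PrW D p (conn a c ∩ (conn a b)ᶜ)) ^ 2 * (PrW D p {S | insert e S ∈ (conn a b ∩ (conn a c)ᶜ)}) - 2 * (PrW D p (conn a c ∩ (conn a b)ᶜ)) * (PrW D p (conn a b ∩ (conn a c)ᶜ)) * (PrW D p {S | insert e S ∈ (conn a b ∩ (conn a c)ᶜ)}) - 2 * (PrW D p (conn a c ∩ (conn a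 b)ᶜ)) * (PrW D p (conn a b ∩ (conn a c)ᶜ)) * (PrW D p {S | insert e S ∈ (conn a c ∩ (conn a b)ᶜ)}) - (PrW D p (conn b c ∩ (conn a b)ᶜ)) * (PrW D p (conn a b ∩ conn a c)) * (PrW D p {S | insert e S ∈ (conn a c ∩ (conn a b)ᶜ)}) - (PrW D p (conn b c ∩ (conn a b)ᶜ)) * (PrW D p (conn a b ∩ conn a c)) * (PrW D p {S | insert e S ∈ (conn a b ∩ (conn a c)ᶜ)}) - (PrW D p (conn a c ∩ (conn a b)ᶜ)) * (PrW D p (conn a b ∩ conn a c)) * (PrW D p {S | insert e S ∈ (conn a b ∩ (conn a c)ᶜ)}) - (PrW D p (conn a c ∩ (conn a b)ᶜ)) * (PrW D p (conn a b ∩ conn a c)) * (PrW D p {S | insert e S ∈ (conn b c ∩ (conn a b)ᶜ)}) - (PrW D p (conn a b ∩ (conn a c)ᶜ)) * (PrW D p (conn a b ∩ conn a c)) * (PrW D p {S | insert e S ∈ (conn b c ∩ (conn a b)ᶜ)}) - (PrW D p (conn a b ∩ (conn a c)ᶜ)) * (PrW D p (conn a b ∩ conn a c)) * (PrW D p {S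 | insert e S ∈ (conn a c ∩ (conn a b)ᶜ)}) - (PrW D p (conn b c ∩ (conn a b)ᶜ)) * (PrW D p (conn a c ∩ (conn a b)ᶜ)) * (PrW D p {S | insert e S ∈ ((conn a b)ᶜ ∩ ((conn a c)ᶜ ∩ (conn b c)ᶜ))}) - (PrW D p (conn b c ∩ (conn a b)ᶜ)) * (PrW D p (conn a b ∩ (conn a c)ᶜ)) * (PrW D p {S | insert e S ∈ ((conn a b)ᶜ ∩ ((conn a c)ᶜ ∩ (conn b c)ᶜ))}) - (PrW D p (conn a c ∩ (conn a b)ᶜ)) * (PrW D p (conn a b ∩ (conn a c)ᶜ)) * (PrW D p {S | insert e S ∈ ((conn a b)ᶜ ∩ ((conn a c)ᶜ ∩ (conn b c)ᶜ))}) + (PrW D p (conn a b ∩ conn a c)) ^ 2 * (PrW D p {S | insert e S ∈ ((conn a b)ᶜ ∩ ((conn a c)ᶜ ∩ (conn b c)ᶜ))}) + (PrW D p (conn b c ∩ (conn a b)ᶜ)) * (PrW D p (conn a b ∩ conn a c)) * (PrW D p {S | insert e S ∈ ((conn a b)ᶜ ∩ ((conn a c)ᶜ ∩ (conn b c)ᶜ))})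 + (PrW D p (conn a c ∩ (conn a b)ᶜ)) * (PrW D p (conn a b ∩ conn a c)) * (PrW D p {S | insert e S ∈ ((conn a b)ᶜ ∩ ((conn a c)ᶜ ∩ (conn b c)ᶜ))}) + (PrW D p (conn a b ∩ (conn a c)ᶜ)) * (PrW D p (conn a b ∩ conn a c)) * (PrW D p {S | insert e S ∈ ((conn a b)ᶜ ∩ ((conn a c)ᶜ ∩ (conn b c)ᶜ))}) - (PrW D p (conn a c ∩ (conn a b)ᶜ)) ^ 2 * (PrW D p {S | insert e S ∈ (conn b c ∩ (conn a b)ᶜ)}) - 4 * (PrW D p (conn a c ∩ (conn a b)ᶜ)) * (PrW D p (conn a b ∩ (conn a c)ᶜ)) * (PrW D p {S | insert e S ∈ (conn b c ∩ (conn a b)ᶜ)}) - (PrW D p (conn a b ∩ (conn a c)ᶜ)) ^ 2 * (PrW D p {S | insert e S ∈ (conn b c ∩ (conn a b)ᶜ)}) - (PrW D p (conn a b ∩ (conn a c)ᶜ)) ^ 2 * (PrW D p {S | insert e S ∈ (conn a c ∩ (conn a b)ᶜ)}) - (PrW D p (conn b c ∩ (conn a b)ᶜ)) * (PrW D p (conn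 a c ∩ (conn a b)ᶜ)) * (PrW D p {S | insert e S ∈ (conn a b ∩ conn a c)}) - (PrW D p (conn b c ∩ (conn a b)ᶜ)) * (PrW D p (conn a b ∩ (conn a c)ᶜ)) * (PrW D p {S | insert e S ∈ (conn a b ∩ conn a c)}) - (PrW D p (conn a c ∩ (conn a b)ᶜ)) * (PrW D p (conn a b ∩ (conn a c)ᶜ)) * (PrW D p {S | insert e S ∈ (conn a b ∩ conn a c)}) := by
  have hp0' : ∀ i, 0 ≤ Function.update p e (1 / 2 : ℝ) i := by
    intro i
    by_cases hi : i = e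
    · rw [hi, Function.update_self]; norm_num
    · rw [Function.update_of_ne hi]; exact hp0 i
  have hp1' : ∀ i, Function.update p e (1 / 2 : ℝ) i ≤ 1 := by
    intro i
    by_cases hi : i = e
    · rw [hi, Function.update_self]; norm_num
    · rw [Function.update_of_ne hi]; exact hp1 i
  have key := xiPolar_one_nonneg hp0' hp1' (insert e D) a b c (Finset.mem_insert_self e D)
  rw [Finset.erase_insert he, Function.update_self] at key
  have hW : ∀ X : Set (Finset (Sym2 V)), PrW D (Function.update p e (1 / 2 : ℝ)) X = PrW D p X :=
    fun X => PrW_congr_weights'' D (fun i hi => Function.update_of_ne (ne_of_mem_of_not_mem hi he) _ _) X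
  have h0 : ∀ E : Set (Finset (Sym2 V)), {S | ins e false S ∈ E} = E := fun E => by
    ext S; simp [ins]
  have h1 : ∀ E : Set (Finset (Sym2 V)), {S | ins e true S ∈ E} = {S | insert e S ∈ E} := fun E => by
    ext S; simp [ins]
  simp only [hW, h0, h1] at key
  exact nonneg_of_mul_nonneg_right key (by norm_num)


/-- **(BΞ2) for every gluing pencil**: `0 ≤ XP21(c⁰; c¹)` for every pair `e ∉ D` of every finite weighted graph. [this work] -/
theorem xiPolar21_nonneg (he : e ∉ D) :
    0 ≤ 2 * (PrW D p ((conn a b)ᶜ ∩ ((conn a c)ᶜ ∩ (conn b c)ᶜ))) * (PrW D p {S | insert e S ∈ ((conn a b)ᶜ ∩ ((conn a c)ᶜ ∩ (conn b c)ᶜ))}) * (PrW D p {S | insert e S ∈ (conn a b ∩ conn a c)}) - (PrW D p ((conn a b)ᶜ ∩ ((conn a c)ᶜ ∩ (conn b c)ᶜ))) * (PrW D p {S | insert e S ∈ (conn b c ∩ (conn a b)ᶜ)}) * (PrW D p {S | insert e S ∈ (conn a c ∩ (conn a b)ᶜ)}) - (PrW D p ((conn a b)ᶜ ∩ ((conn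 a c)ᶜ ∩ (conn b c)ᶜ))) * (PrW D p {S | insert e S ∈ (conn b c ∩ (conn a b)ᶜ)}) * (PrW D p {S | insert e S ∈ (conn a b ∩ (conn a c)ᶜ)}) - (PrW D p ((conn a b)ᶜ ∩ ((conn a c)ᶜ ∩ (conn b c)ᶜ))) * (PrW D p {S | insert e S ∈ (conn a c ∩ (conn a b)ᶜ)}) * (PrW D p {S | insert e S ∈ (conn a b ∩ (conn a c)ᶜ)}) + (PrW D p ((conn a b)ᶜ ∩ ((conn a c)ᶜ ∩ (conn b c)ᶜ))) * (PrW D p {S | insert e S ∈ (conn a b ∩ conn a c)}) ^ 2 + (PrW D p ((conn a b)ᶜ ∩ ((conn a c)ᶜ ∩ (conn b c)ᶜ))) * (PrW D p {S | insert e S ∈ (conn b c ∩ (conn a b)ᶜ)}) * (PrW D p {S | insert e S ∈ (conn a b ∩ conn a c)}) + (PrW D p ((conn a b)ᶜ ∩ ((conn a c)ᶜ ∩ (conn b c)ᶜ))) * (PrW D p {S | insert e S ∈ (conn a c ∩ (conn a b)ᶜ)}) * (PrW D p {S | insert e S ∈ (conn a b ∩ conn a c)}) + (PrW D p ((conn a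 b)ᶜ ∩ ((conn a c)ᶜ ∩ (conn b c)ᶜ))) * (PrW D p {S | insert e S ∈ (conn a b ∩ (conn a c)ᶜ)}) * (PrW D p {S | insert e S ∈ (conn a b ∩ conn a c)}) - 2 * (PrW D p (conn b c ∩ (conn a b)ᶜ)) * (PrW D p {S | insert e S ∈ (conn b c ∩ (conn a b)ᶜ)}) * (PrW D p {S | insert e S ∈ (conn a c ∩ (conn a b)ᶜ)}) - 2 * (PrW D p (conn b c ∩ (conn a b)ᶜ)) * (PrW D p {S | insert e S ∈ (conn b c ∩ (conn a b)ᶜ)}) * (PrW D p {S | insert e S ∈ (conn a b ∩ (conn a c)ᶜ)}) - (PrW D p (conn b c ∩ (conn a b)ᶜ)) * (PrW D p {S | insert e S ∈ (conn a c ∩ (conn a b)ᶜ)}) ^ 2 - 4 * (PrW D p (conn b c ∩ (conn a b)ᶜ)) * (PrW D p {S | insert e S ∈ (conn a c ∩ (conn a b)ᶜ)}) * (PrW D p {S | insert e S ∈ (conn a b ∩ (conn a c)ᶜ)}) - (PrW D p (conn b c ∩ (conn a b)ᶜ)) * (PrW D p {S | insert e S ∈ (conn a b ∩ (conn a c)ᶜ)})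 ^ 2 - 2 * (PrW D p (conn a c ∩ (conn a b)ᶜ)) * (PrW D p {S | insert e S ∈ (conn a c ∩ (conn a b)ᶜ)}) * (PrW D p {S | insert e S ∈ (conn a b ∩ (conn a c)ᶜ)}) - (PrW D p (conn a c ∩ (conn a b)ᶜ)) * (PrW D p {S | insert e S ∈ (conn a b ∩ (conn a c)ᶜ)}) ^ 2 - (PrW D p (conn a b ∩ conn a c)) * (PrW D p {S | insert e S ∈ (conn b c ∩ (conn a b)ᶜ)}) * (PrW D p {S | insert e S ∈ (conn a c ∩ (conn a b)ᶜ)}) - (PrW D p (conn a b ∩ conn a c)) * (PrW D p {S | insert e S ∈ (conn b c ∩ (conn a b)ᶜ)}) * (PrW D p {S | insert e S ∈ (conn a b ∩ (conn a c)ᶜ)}) - (PrW D p (conn a b ∩ conn a c)) * (PrW D p {S | insert e S ∈ (conn a c ∩ (conn a b)ᶜ)}) * (PrW D p {S | insert e S ∈ (conn a b ∩ (conn a c)ᶜ)}) + (PrW D p (conn a b ∩ conn a c)) * (PrW D p {S | insert e S ∈ ((conn a b)ᶜ ∩ ((conn a c)ᶜ ∩ (conn b c)ᶜ))}) ^ 2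 - (PrW D p (conn b c ∩ (conn a b)ᶜ)) * (PrW D p {S | insert e S ∈ ((conn a b)ᶜ ∩ ((conn a c)ᶜ ∩ (conn b c)ᶜ))}) * (PrW D p {S | insert e S ∈ (conn a c ∩ (conn a b)ᶜ)}) - (PrW D p (conn b c ∩ (conn a b)ᶜ)) * (PrW D p {S | insert e S ∈ ((conn a b)ᶜ ∩ ((conn a c)ᶜ ∩ (conn b c)ᶜ))}) * (PrW D p {S | insert e S ∈ (conn a b ∩ (conn a c)ᶜ)}) - (PrW D p (conn a c ∩ (conn a b)ᶜ)) * (PrW D p {S | insert e S ∈ ((conn a b)ᶜ ∩ ((conn a c)ᶜ ∩ (conn b c)ᶜ))}) * (PrW D p {S | insert e S ∈ (conn a b ∩ (conn a c)ᶜ)}) + (PrW D p (conn a b ∩ conn a c)) * (PrW D p {S | insert e S ∈ ((conn a b)ᶜ ∩ ((conn a c)ᶜ ∩ (conn b c)ᶜ))}) * (PrW D p {S | insert e S ∈ (conn b c ∩ (conn a b)ᶜ)}) + (PrW D p (conn a b ∩ conn a c)) * (PrW D p {S | insert e S ∈ ((conn a b)ᶜ ∩ ((conn a c)ᶜ ∩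 (conn b c)ᶜ))}) * (PrW D p {S | insert e S ∈ (conn a c ∩ (conn a b)ᶜ)}) + (PrW D p (conn a b ∩ conn a c)) * (PrW D p {S | insert e S ∈ ((conn a b)ᶜ ∩ ((conn a c)ᶜ ∩ (conn b c)ᶜ))}) * (PrW D p {S | insert e S ∈ (conn a b ∩ (conn a c)ᶜ)}) + 2 * (PrW D p (conn a b ∩ conn a c)) * (PrW D p {S | insert e S ∈ ((conn a b)ᶜ ∩ ((conn a c)ᶜ ∩ (conn b c)ᶜ))}) * (PrW D p {S | insert e S ∈ (conn a b ∩ conn a c)}) - (PrW D p (conn a c ∩ (conn a b)ᶜ)) * (PrW D p {S | insert e S ∈ ((conn a b)ᶜ ∩ ((conn a c)ᶜ ∩ (conn b c)ᶜ))}) * (PrW D p {S | insert e S ∈ (conn b c ∩ (conn a b)ᶜ)}) - (PrW D p (conn a b ∩ (conn a c)ᶜ)) * (PrW D p {S | insert e S ∈ ((conn a b)ᶜ ∩ ((conn a c)ᶜ ∩ (conn b c)ᶜ))}) * (PrW D p {S | insert e S ∈ (conn b c ∩ (conn a b)ᶜ)}) - (PrW D p (conn a b ∩ (conn a c)ᶜ))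 * (PrW D p {S | insert e S ∈ ((conn a b)ᶜ ∩ ((conn a c)ᶜ ∩ (conn b c)ᶜ))}) * (PrW D p {S | insert e S ∈ (conn a c ∩ (conn a b)ᶜ)}) + (PrW D p (conn b c ∩ (conn a b)ᶜ)) * (PrW D p {S | insert e S ∈ ((conn a b)ᶜ ∩ ((conn a c)ᶜ ∩ (conn b c)ᶜ))}) * (PrW D p {S | insert e S ∈ (conn a b ∩ conn a c)}) + (PrW D p (conn a c ∩ (conn a b)ᶜ)) * (PrW D p {S | insert e S ∈ ((conn a b)ᶜ ∩ ((conn a c)ᶜ ∩ (conn b c)ᶜ))}) * (PrW D p {S | insert e S ∈ (conn a b ∩ conn a c)}) + (PrW D p (conn a b ∩ (conn a c)ᶜ)) * (PrW D p {S | insert e S ∈ ((conn a b)ᶜ ∩ ((conn a c)ᶜ ∩ (conn b c)ᶜ))}) * (PrW D p {S | insert e S ∈ (conn a b ∩ conn a c)}) - (PrW D p (conn a c ∩ (conn a b)ᶜ)) * (PrW D p {S | insert e S ∈ (conn b c ∩ (conn a b)ᶜ)}) ^ 2 - (PrW D p (conn a b ∩ (conn a c)ᶜ)) * (PrW D p {S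 | insert e S ∈ (conn b c ∩ (conn a b)ᶜ)}) ^ 2 - 2 * (PrW D p (conn a c ∩ (conn a b)ᶜ)) * (PrW D p {S | insert e S ∈ (conn b c ∩ (conn a b)ᶜ)}) * (PrW D p {S | insert e S ∈ (conn a c ∩ (conn a b)ᶜ)}) - 4 * (PrW D p (conn a c ∩ (conn a b)ᶜ)) * (PrW D p {S | insert e S ∈ (conn b c ∩ (conn a b)ᶜ)}) * (PrW D p {S | insert e S ∈ (conn a b ∩ (conn a c)ᶜ)}) - 2 * (PrW D p (conn a b ∩ (conn a c)ᶜ)) * (PrW D p {S | insert e S ∈ (conn b c ∩ (conn a b)ᶜ)}) * (PrW D p {S | insert e S ∈ (conn a b ∩ (conn a c)ᶜ)}) - 4 * (PrW D p (conn a b ∩ (conn a c)ᶜ)) * (PrW D p {S | insert e S ∈ (conn b c ∩ (conn a b)ᶜ)}) * (PrW D p {S | insert e S ∈ (conn a c ∩ (conn a b)ᶜ)}) - (PrW D p (conn a b ∩ (conn a c)ᶜ)) * (PrW D p {S | insert e S ∈ (conn a c ∩ (conn a b)ᶜ)}) ^ 2 - 2 * (PrW D p (conn a b ∩ (conn a c)ᶜ))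 * (PrW D p {S | insert e S ∈ (conn a c ∩ (conn a b)ᶜ)}) * (PrW D p {S | insert e S ∈ (conn a b ∩ (conn a c)ᶜ)}) - (PrW D p (conn b c ∩ (conn a b)ᶜ)) * (PrW D p {S | insert e S ∈ (conn a c ∩ (conn a b)ᶜ)}) * (PrW D p {S | insert e S ∈ (conn a b ∩ conn a c)}) - (PrW D p (conn b c ∩ (conn a b)ᶜ)) * (PrW D p {S | insert e S ∈ (conn a b ∩ (conn a c)ᶜ)}) * (PrW D p {S | insert e S ∈ (conn a b ∩ conn a c)}) - (PrW D p (conn a c ∩ (conn a b)ᶜ)) * (PrW D p {S | insert e S ∈ (conn a b ∩ (conn a c)ᶜ)}) * (PrW D p {S | insert e S ∈ (conn a b ∩ conn a c)}) - (PrW D p (conn a c ∩ (conn a b)ᶜ)) * (PrW D p {S | insert e S ∈ (conn b c ∩ (conn a b)ᶜ)}) * (PrW D p {S | insert e S ∈ (conn a b ∩ conn a c)}) - (PrW D p (conn a b ∩ (conn a c)ᶜ)) * (PrW D p {S | insert e S ∈ (conn b c ∩ (conn a b)ᶜ)}) * (PrW D p {S | insert e S ∈ (conn a b ∩ conn a c)})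 - (PrW D p (conn a b ∩ (conn a c)ᶜ)) * (PrW D p {S | insert e S ∈ (conn a c ∩ (conn a b)ᶜ)}) * (PrW D p {S | insert e S ∈ (conn a b ∩ conn a c)}) := by
  have hp0' : ∀ i, 0 ≤ Function.update p e (1 / 2 : ℝ) i := by
    intro i
    by_cases hi : i = e
    · rw [hi, Function.update_self]; norm_num
    · rw [Function.update_of_ne hi]; exact hp0 i
  have hp1' : ∀ i, Function.update p e (1 / 2 : ℝ) i ≤ 1 := by
    intro i
    by_cases hi : i = e
    · rw [hi, Function.update_self]; norm_num
    · rw [Function.update_of_ne hi]; exact hp1 i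
  have key := xiPolar_two_nonneg hp0' hp1' (insert e D) a b c (Finset.mem_insert_self e D)
  rw [Finset.erase_insert he, Function.update_self] at key
  have hW : ∀ X : Set (Finset (Sym2 V)), PrW D (Function.update p e (1 / 2 : ℝ)) X = PrW D p X :=
    fun X => PrW_congr_weights'' D (fun i hi => Function.update_of_ne (ne_of_mem_of_not_mem hi he) _ _) X
  have h0 : ∀ E : Set (Finset (Sym2 V)), {S | ins e false S ∈ E} = E := fun E => by
    ext S; simp [ins]
  have h1 : ∀ E : Set (Finset (Sym2 V)), {S | ins e true S ∈ E} = {S | insert e S ∈ E} := fun E => by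
    ext S; simp [ins]
  simp only [hW, h0, h1] at key
  exact nonneg_of_mul_nonneg_right key (by norm_num)


/-- **(BΞ1) in the tree's transition vocabulary**: with `q¹ = q−α₁−α₂`, `u_c¹ = u_c+α₁−β₁`, `u_b¹ = u_b+α₂−β₂`, `u_a¹ = u_a−β₃`,
`t¹ = t+β₁+β₂+β₃` (automatic for an apex pair `e ∋ a`): `0 ≤ TerminalEdgeStep.xiB₁ q u_c u_b u_a t α₁ α₂ β₁ β₂ β₃`. [this work] -/
theorem xiB₁_nonneg_of_transitions (he : e ∉ D) {α₁ α₂ β₁ β₂ β₃ : ℝ}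
    (hq : PrW D p {S | insert e S ∈ ((conn a b)ᶜ ∩ ((conn a c)ᶜ ∩ (conn b c)ᶜ))} = PrW D p ((conn a b)ᶜ ∩ ((conn a c)ᶜ ∩ (conn b c)ᶜ)) - α₁ - α₂)
    (hc : PrW D p {S | insert e S ∈ (conn a b ∩ (conn a c)ᶜ)} = PrW D p (conn a b ∩ (conn a c)ᶜ) + α₁ - β₁)
    (hb : PrW D p {S | insert e S ∈ (conn a c ∩ (conn a b)ᶜ)} = PrW D p (conn a c ∩ (conn a b)ᶜ) + α₂ - β₂)
    (ha : PrW D p {S | insert e S ∈ (conn b c ∩ (conn a b)ᶜ)} = PrW D p (conn b c ∩ (conn a b)ᶜ) - β₃)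
    (ht : PrW D p {S | insert e S ∈ (conn a b ∩ conn a c)} = PrW D p (conn a b ∩ conn a c) + β₁ + β₂ + β₃) :
    0 ≤ TerminalEdgeStep.xiB₁ (PrW D p ((conn a b)ᶜ ∩ ((conn a c)ᶜ ∩ (conn b c)ᶜ))) (PrW D p (conn a b ∩ (conn a c)ᶜ)) (PrW D p (conn a c ∩ (conn a b)ᶜ)) (PrW D p (conn b c ∩ (conn a b)ᶜ)) (PrW D p (conn a b ∩ conn a c)) α₁ α₂ β₁ β₂ β₃ := by
  have key := xiPolar12_nonneg hp0 hp1 D a b c he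
  rw [hq, hc, hb, ha, ht] at key
  rw [xiB₁_eq_polar]
  exact key


/-- **(BΞ2) in the tree's transition vocabulary**: with `q¹ = q−α₁−α₂`, `u_c¹ = u_c+α₁−β₁`, `u_b¹ = u_b+α₂−β₂`, `u_a¹ = u_a−β₃`,
`t¹ = t+β₁+β₂+β₃` (automatic for an apex pair `e ∋ a`): `0 ≤ TerminalEdgeStep.xiB₂ q u_c u_b u_a t α₁ α₂ β₁ β₂ β₃`. [this work] -/
theorem xiB₂_nonneg_of_transitions (he : e ∉ D) {α₁ α₂ β₁ β₂ β₃ : ℝ}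
    (hq : PrW D p {S | insert e S ∈ ((conn a b)ᶜ ∩ ((conn a c)ᶜ ∩ (conn b c)ᶜ))} = PrW D p ((conn a b)ᶜ ∩ ((conn a c)ᶜ ∩ (conn b c)ᶜ)) - α₁ - α₂)
    (hc : PrW D p {S | insert e S ∈ (conn a b ∩ (conn a c)ᶜ)} = PrW D p (conn a b ∩ (conn a c)ᶜ) + α₁ - β₁)
    (hb : PrW D p {S | insert e S ∈ (conn a c ∩ (conn a b)ᶜ)} = PrW D p (conn a c ∩ (conn a b)ᶜ) + α₂ - β₂)
    (ha : PrW D p {S | insert e S ∈ (conn b c ∩ (conn a b)ᶜ)} = PrW D p (conn b c ∩ (conn a b)ᶜ) - β₃)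
    (ht : PrW D p {S | insert e S ∈ (conn a b ∩ conn a c)} = PrW D p (conn a b ∩ conn a c) + β₁ + β₂ + β₃) :
    0 ≤ TerminalEdgeStep.xiB₂ (PrW D p ((conn a b)ᶜ ∩ ((conn a c)ᶜ ∩ (conn b c)ᶜ))) (PrW D p (conn a b ∩ (conn a c)ᶜ)) (PrW D p (conn a c ∩ (conn a b)ᶜ)) (PrW D p (conn b c ∩ (conn a b)ᶜ)) (PrW D p (conn a b ∩ conn a c)) α₁ α₂ β₁ β₂ β₃ := by
  have key := xiPolar21_nonneg hp0 hp1 D a b c he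
  rw [hq, hc, hb, ha, ht] at key
  rw [xiB₂_eq_polar]
  exact key

end Pencil

end AGPlusFibre

end Summit.CriticalPhenomena.PercolationContinuityZ3.Theorems

end
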